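import Summits.HodgeConjecture.HodgeConjecture.Theorems.WeilTypeLadderQuaternionicPrym
import Summits.HodgeConjecture.HodgeConjecture.Theorems.WeilTypeLadderOnPath
import Literature.AlgebraicGeometry.HodgeTheory.WeilClassesCyclicPrymDegreeFour
import HarnessLib

/-!
# WeilTypeLadder · the rung R2₈ (`SplitEightfolds`) on the quaternionic Prym locus (van Geemen–Verra 2003)

b2b cell `hweil` (CENSUS.md `## P3-g35`; prover 3). Companion of `Theorems/WeilTypeLadderQuaternionicPrym.lean` (read its
module docstring): the literal body of the ladder rung `WeilTypeLadder.SplitEightfolds` (R2₈: Weil classes on abelian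
EIGHTFOLDS of split Weil type, every `d`) at `(A, φ, d) := (P, x, p²+q²+r²)` — `P` the Prym eightfold of a quaternionic
cover with `ℍ_ℤ = ℤ⟨ι_P, j_P⟩ ⊂ End(P)`, `x = p ι_P + q j_P + r ι_P j_P ≠ 0`, `K = ℚ(x) ≅ ℚ(√-(p²+q²+r²))` — (i) FOLLOWS
from the two refereed named facts `Schoen1988_cyclicPrym_weilClasses_algebraic_degreeFour` (Schoen 1988 Cor. 3.1 at
`m = 4`) and `VanGeemenVerra2003_quaternionHodgeClasses` (Prop. 4.7) together with a `Q`-invariant hyperplane class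
(the hyperbolicity binder of the rung is carried unused: the facts give every class of the Weil plane); (ii) follows
from the rung itself (the locus is a CASE of R2₈); (iii) follows from `HodgeConjecture` (on-path, via
`splitEightfolds_of_hodgeConjecture`).

HONEST LABEL. Known since 2003; a `6`-dimensional locus inside the 16-dimensional moduli of `(4,4)` Weil eightfolds of
each `K ⊂ ℍ_ℚ`; which discriminant component it meets is a packet-level computation (`b2b-hweil-pv3-g35/`), NOT asserted
in Lean; cases, not rungs; Markman-free; 0 unconditional rungs above the floor are added.
-/

noncomputable section

-- every declaration of this problem lives in `Summit.HodgeConjecture.HodgeConjecture.…` (summit = sub-problem)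
set_option linter.dupNamespace false

open CategoryTheory
open Literature.AlgebraicGeometry Literature.AlgebraicGeometry.Motives
open Literature.AlgebraicGeometry.HodgeTheory
open Literature.AlgebraicTopology.SingularHomology
open Literature.AlgebraicGeometry.VanGeemenVerra2003

namespace Summit.HodgeConjecture.HodgeConjecture.WeilTypeLadder

/-! ### R2₈ (`SplitEightfolds`) on the quaternionic Prym locus -/

section SplitEightfolds

/-- **R2₈ on the quaternionic Prym locus (`SplitEightfolds` at `d = p²+q²+r²`, `(A, φ) := (P, x)`), from the two
refereed facts**: the literal body of the rung — for every projective embedding `e'`, every rational `a ≠ 0` with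
hyperbolic `K`-symmetrised class, every rational `(4,4)`-class of `weilClassesOf P x 4 d` is algebraic; the
hyperbolicity binder is carried unused (the facts give every class of the plane; which discriminant component the
locus meets is a packet-level statement, not asserted here). [cite: vanGeemenVerra2003QuaternionicPryms, Cor. 4.10 with Prop. 4.7] -/
theorem splitEightfolds_quaternionicPrym_of_schoen_vanGeemenVerra
    (hS : Schoen1988_cyclicPrym_weilClasses_algebraic_degreeFour)
    (hV : VanGeemenVerra2003_quaternionHodgeClasses) :
    ∀ (C : SchemeOver ℂ) (𝒥 : Jacobian C) (ι j : C ⟶ C),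
      IsSmoothProjective 1 C → 𝒥.J.dim = 17 →
      ι ≫ ι ≫ ι ≫ ι = 𝟙 C → j ≫ j = ι ≫ ι → ι ≫ j ≫ ι = j →
      (∀ P : ComplexPoints C, P ≫ (ι ≫ ι) ≠ P) →
    ∀ (e : 𝒥.J ⟶ 𝒥.J), e = 𝒥.pushforward 𝒥 (ι ≫ ι) →
    ∀ (ιP jP : AbelianVariety.kerComponent (𝟙 𝒥.J + e) ⟶ AbelianVariety.kerComponent (𝟙 𝒥.J + e)),
      ιP ≫ AbelianVariety.kerComponentι (𝟙 𝒥.J + e) =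
        AbelianVariety.kerComponentι (𝟙 𝒥.J + e) ≫ 𝒥.pushforward 𝒥 ι →
      jP ≫ AbelianVariety.kerComponentι (𝟙 𝒥.J + e) =
        AbelianVariety.kerComponentι (𝟙 𝒥.J + e) ≫ 𝒥.pushforward 𝒥 j →
    ∀ (emb : ProjectiveEmbedding (AbelianVariety.kerComponent (𝟙 𝒥.J + e)).X)
      (l : complexBetti (projectiveSpace emb.n ℂ) 2), IsRationalClass l → l ≠ 0 →
      complexBetti.map ιP.hom.hom.hom 2 (complexBetti.map emb.ι 2 l) = complexBetti.map emb.ι 2 l →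
      complexBetti.map jP.hom.hom.hom 2 (complexBetti.map emb.ι 2 l) = complexBetti.map emb.ι 2 l →
    ∀ (p q r : ℤ), (p ≠ 0 ∨ q ≠ 0 ∨ r ≠ 0) → ∀ (m : ℕ), (m : ℤ) = p ^ 2 + q ^ 2 + r ^ 2 →
      (AbelianVariety.kerComponent (𝟙 𝒥.J + e)).dim = 2 * 4 →
      IsSmoothProjective (2 * 4) (AbelianVariety.kerComponent (𝟙 𝒥.J + e)).X →
      (p • ιP + q • jP + r • (ιP ≫ jP)) ≫ (p • ιP + q • jP + r • (ιP ≫ jP)) = -(m • 𝟙 _) →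
      ∀ (e' : ProjectiveEmbedding (AbelianVariety.kerComponent (𝟙 𝒥.J + e)).X)
        (a : complexBetti (projectiveSpace e'.n ℂ) 2), IsRationalClass a → a ≠ 0 →
        IsHyperbolicWeilType (AbelianVariety.kerComponent (𝟙 𝒥.J + e)) (p • ιP + q • jP + r • (ιP ≫ jP)) 4
          ((m : ℂ) • complexBetti.map e'.ι 2 a +
            complexBetti.map (p • ιP + q • jP + r • (ιP ≫ jP)).hom.hom.hom 2 (complexBetti.map e'.ι 2 a)) →
      ∀ c : complexBetti (AbelianVariety.kerComponent (𝟙 𝒥.J + e)).X (2 * 4), IsRationalClass c →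
        IsOfHodgeType (2 * 4) (AbelianVariety.kerComponent (𝟙 𝒥.J + e)).X (2 * 4) 4 4 c →
        c ∈ weilClassesOf (AbelianVariety.kerComponent (𝟙 𝒥.J + e)) (p • ιP + q • jP + r • (ιP ≫ jP)) 4 m →
        c ∈ algebraicClasses (AbelianVariety.kerComponent (𝟙 𝒥.J + e)).X 4 := by
  intro C 𝒥 ι j hC h17 hι4 hjj hq hfree e he ιP jP hιP hjP emb l hl hl0 hθι hθj p q r hpqr m hm hdim _ _
    _ _ _ _ _ c _ _ hW
  exact weilClassesOf_quaternionicPrym_le_algebraicClasses hS hV C 𝒥 ι j hC h17 hι4 hjj hq hfree e he ιP jP hιP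
    hjP (by rw [hdim]) emb l hl hl0 hθι hθj p q r hpqr m hm hW

/-- **The same R2₈ body from the rung `SplitEightfolds` itself** (at `d = p²+q²+r²`, `(A, φ) := (P, x)`): the
quaternionic Prym locus is a CASE of the rung (no fact, no `Q`-invariant class needed). -/
theorem splitEightfolds_quaternionicPrym_of_splitEightfolds (h : SplitEightfolds) :
    ∀ (C : SchemeOver ℂ) (𝒥 : Jacobian C) (ι j : C ⟶ C),
    ∀ (e : 𝒥.J ⟶ 𝒥.J),
    ∀ (ιP jP : AbelianVariety.kerComponent (𝟙 𝒥.J + e) ⟶ AbelianVariety.kerComponent (𝟙 𝒥.J + e)),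
    ∀ (p q r : ℤ) (m : ℕ), 0 < m →
      (AbelianVariety.kerComponent (𝟙 𝒥.J + e)).dim = 2 * 4 →
      IsSmoothProjective (2 * 4) (AbelianVariety.kerComponent (𝟙 𝒥.J + e)).X →
      (p • ιP + q • jP + r • (ιP ≫ jP)) ≫ (p • ιP + q • jP + r • (ιP ≫ jP)) = -(m • 𝟙 _) →
      ∀ (e' : ProjectiveEmbedding (AbelianVariety.kerComponent (𝟙 𝒥.J + e)).X)
        (a : complexBetti (projectiveSpace e'.n ℂ) 2), IsRationalClass a → a ≠ 0 →
        IsHyperbolicWeilType (AbelianVariety.kerComponent (𝟙 𝒥.J + e)) (p • ιP + q • jP + r • (ιP ≫ jP)) 4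
          ((m : ℂ) • complexBetti.map e'.ι 2 a +
            complexBetti.map (p • ιP + q • jP + r • (ιP ≫ jP)).hom.hom.hom 2 (complexBetti.map e'.ι 2 a)) →
      ∀ c : complexBetti (AbelianVariety.kerComponent (𝟙 𝒥.J + e)).X (2 * 4), IsRationalClass c →
        IsOfHodgeType (2 * 4) (AbelianVariety.kerComponent (𝟙 𝒥.J + e)).X (2 * 4) 4 4 c →
        c ∈ weilClassesOf (AbelianVariety.kerComponent (𝟙 𝒥.J + e)) (p • ιP + q • jP + r • (ιP ≫ jP)) 4 m →
        c ∈ algebraicClasses (AbelianVariety.kerComponent (𝟙 𝒥.J + e)).X 4 := by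
  intro C 𝒥 ι j e ιP jP p q r m hm hdim hX hx e' a ha ha0 hh c hc h44 hW
  exact h m hm _ _ hdim hX hx e' a ha ha0 hh c hc h44 hW

/-- **On-path lemma**: the Hodge conjecture implies R2₈ on the quaternionic Prym locus
(`HodgeConjecture → SplitEightfolds →` the locus). -/
theorem splitEightfolds_quaternionicPrym_of_hodgeConjecture (h : _root_.HodgeConjecture) :
    ∀ (C : SchemeOver ℂ) (𝒥 : Jacobian C) (ι j : C ⟶ C),
    ∀ (e : 𝒥.J ⟶ 𝒥.J),
    ∀ (ιP jP : AbelianVariety.kerComponent (𝟙 𝒥.J + e) ⟶ AbelianVariety.kerComponent (𝟙 𝒥.J + e)),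
    ∀ (p q r : ℤ) (m : ℕ), 0 < m →
      (AbelianVariety.kerComponent (𝟙 𝒥.J + e)).dim = 2 * 4 →
      IsSmoothProjective (2 * 4) (AbelianVariety.kerComponent (𝟙 𝒥.J + e)).X →
      (p • ιP + q • jP + r • (ιP ≫ jP)) ≫ (p • ιP + q • jP + r • (ιP ≫ jP)) = -(m • 𝟙 _) →
      ∀ (e' : ProjectiveEmbedding (AbelianVariety.kerComponent (𝟙 𝒥.J + e)).X)
        (a : complexBetti (projectiveSpace e'.n ℂ) 2), IsRationalClass a → a ≠ 0 →
        IsHyperbolicWeilType (AbelianVariety.kerComponent (𝟙 𝒥.J + e)) (p • ιP + q • jP + r • (ιP ≫ jP)) 4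
          ((m : ℂ) • complexBetti.map e'.ι 2 a +
            complexBetti.map (p • ιP + q • jP + r • (ιP ≫ jP)).hom.hom.hom 2 (complexBetti.map e'.ι 2 a)) →
      ∀ c : complexBetti (AbelianVariety.kerComponent (𝟙 𝒥.J + e)).X (2 * 4), IsRationalClass c →
        IsOfHodgeType (2 * 4) (AbelianVariety.kerComponent (𝟙 𝒥.J + e)).X (2 * 4) 4 4 c →
        c ∈ weilClassesOf (AbelianVariety.kerComponent (𝟙 𝒥.J + e)) (p • ιP + q • jP + r • (ιP ≫ jP)) 4 m →
        c ∈ algebraicClasses (AbelianVariety.kerComponent (𝟙 𝒥.J + e)).X 4 :=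
  splitEightfolds_quaternionicPrym_of_splitEightfolds (splitEightfolds_of_hodgeConjecture h)

end SplitEightfolds

end Summit.HodgeConjecture.HodgeConjecture.WeilTypeLadder

end
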